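import Literature.Analysis.FluidPDE.HardSphereCollisionRecord
import HarnessLib

/-!
# The empirical collision measure: integration API

Companion to `Literature.Analysis.FluidPDE.HardSphereCollisionRecord`, which DEFINES the marked
point measure of the collisions of a hard-sphere trajectory,
`collisionMeasure G ε γ S = Σ_{t ∈ collisionTimes ∩ S} Σ_{(i, j) ∈ contactPairs (γ t)} δ_{(t, x_i, ε⁻¹(x_i - x_j), v_i⁻, v_j⁻)}`
on `ℝ × X × ℝ^d × ℝ^d × ℝ^d`, and its flow version
`HardSphereFlow.empiricalCollisionMeasure Φ S z` (the UNNORMALISED empirical collision measure of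
the orbit of `z`; Bogolyubov's microscopic Enskog equation for the empirical measure of one
trajectory has exactly these collision sums on its right-hand side, Bogolyubov 1975,
Pulvirenti–Simonella 2015 §3 Thm 1). Nothing is (re)defined here; this file adds the three
pieces of API that statements integrating against that measure consume:

* **integrability and finiteness without side conditions**: `collisionMeasure` is a `finsum` of
  finite sums of Dirac masses (junk value `0` when infinitely many collision times lie in the
  window), hence ALWAYS a finite measure against which EVERY function is Bochner integrable
  (`isFiniteMeasure_collisionMeasure'`, `integrable_collisionMeasure`, and the flow versions
  `HardSphereFlow.isFiniteMeasure_empiricalCollisionMeasure'`,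
  `HardSphereFlow.integrable_empiricalCollisionMeasure`) — so `integral_add/sub/smul` apply
  freely; the record file proves finiteness only for finitely many collision times;
* **one-step unfolding to the inline collision sums of route statements**:
  `∫ f dκ = ∑ᶠ s ∈ collisionTimes ∩ S, ∑ i, ∑ j, if i ≠ j ∧ ‖x_i(s) - x_j(s)‖ = ε then f (s, x_i(s), ε⁻¹ (x_i(s) - x_j(s)), (reflectVel (x_i - x_j) (v_i, v_j)).1, (reflectVel …).2) else 0`
  (`integral_collisionMeasure_eq_finsum_ite`, `lintegral_collisionMeasure_eq_finsum_ite`,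
  `HardSphereFlow.integral_empiricalCollisionMeasure_eq_finsum_ite`,
  `HardSphereFlow.lintegral_empiricalCollisionMeasure_eq_finsum_ite`), combining
  `integral_collisionMeasure`, `collisionSum_eq_collisionPairSum`,
  `collisionPairSum_eq_finsum_ite` and the definitional unfolding of
  `HardSphereCollisionRecord.ofConfig`/`.mark`;
* **total mass** over a closed window in a hard-sphere regular geometry (`ℝ^d`; `T^d` with
  `ε < 1/2`): `κ([a, b]-window)(univ) = 2 · numCollisions G ε γ a b` in `ℝ≥0∞` — each binary
  collision is recorded in its two orders (`IsHardSphereTrajectory.collisionMeasure_Icc_univ`,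
  `HardSphereFlow.empiricalCollisionMeasure_Icc_univ`; from `collisionMeasure_univ` and
  `IsHardSphereTrajectory.card_contactPairs_eq_two`).

## Mathlib / Literature reuse

Everything about the measure itself is `HardSphereCollisionRecord`'s (`collisionMeasure`,
`collisionSum`, `collisionPairSum`, `contactPairs`, `HardSphereCollisionRecord.ofConfig/mark`,
`integral_collisionMeasure`, `lintegral_collisionMeasure`, `collisionMeasure_univ`,
`collisionPairSum_eq_finsum_ite`, `IsHardSphereTrajectory.card_contactPairs_eq_two`,
`HardSphereFlow.finite_collisionTimes_inter`); `finsum_mem_induction`, `integrable_dirac`,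
`integrable_finsetSum_measure`, `Integrable.add_measure` and the finite-measure instances for
finite sums of Dirac masses are Mathlib's.

## Design choices

* A separate companion file rather than an append to the (long) record file: pure theorems, no
  new definition, no named fact.
* Finiteness is stated as theorems (`haveI := isFiniteMeasure_collisionMeasure' …`), not as
  global instances.
* Deliberately NOT here (as in the record file): measurability of
  `z ↦ ∫ f d(Φ.empiricalCollisionMeasure S z)` on the good set, which needs joint measurability
  of `(t, z) ↦ Φ_t z` — not a field of the hypothesis structure `HardSphereFlow`.

## References

* N. N. Bogolyubov, *Microscopic solutions of the Boltzmann–Enskog equation in kinetic theory for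
  elastic balls*, Theor. Math. Phys. 24 (1975), 804–807.
* M. Pulvirenti, S. Simonella, *On the evolution of the empirical measure for the hard-sphere
  dynamics*, Bull. Inst. Math. Acad. Sin. (N.S.) 10 (2015), arXiv:1504.03215, §1 (1.3)–(1.5),
  §3 Thm 1.
-/

open Set Function
open _root_.MeasureTheory
open scoped ENNReal

namespace Literature.Analysis.FluidPDE

noncomputable section

section Kinetic

variable {d : Type*} [Fintype d] {X : Type*} {N : ℕ} {G : Geometry d X} {ε : ℝ}

section Curve

variable [MeasurableSpace X]

/-! ## Finiteness and integrability without side conditions -/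

/-- The collision measure of any curve over any set of times is a finite measure: a `finsum`
(junk value `0` on an infinite support) of finite sums of Dirac masses. Compare
`isFiniteMeasure_collisionMeasure`, which assumes finitely many collision times. [folklore] -/
theorem isFiniteMeasure_collisionMeasure' (G : Geometry d X) (ε : ℝ) (γ : ℝ → Config N d X)
    (S : Set ℝ) : IsFiniteMeasure (collisionMeasure G ε γ S) := by
  unfold collisionMeasure collisionSum collisionPairSum
  exact finsum_mem_induction (fun μ => IsFiniteMeasure μ) (by infer_instance)
    (fun μ ν hμ hν => by haveI := hμ; haveI := hν; infer_instance) fun _ _ => inferInstance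

/-- **Every function is Bochner integrable against the collision measure** (finitely many atoms,
or the zero measure), so that `integral_add`, `integral_sub`, `integral_smul`, … apply without
further hypotheses. [folklore] -/
theorem integrable_collisionMeasure [MeasurableSingletonClass X] {E : Type*}
    [NormedAddCommGroup E] (γ : ℝ → Config N d X) (S : Set ℝ)
    (f : ℝ × X × EuclideanSpace ℝ d × EuclideanSpace ℝ d × EuclideanSpace ℝ d → E) :
    Integrable f (collisionMeasure G ε γ S) := by
  unfold collisionMeasure collisionSum collisionPairSum
  exact finsum_mem_induction (fun μ => Integrable f μ) integrable_zero_measure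
    (fun _ _ hμ hν => hμ.add_measure hν) fun _ _ =>
      integrable_finsetSum_measure.2 fun _ _ => integrable_dirac (by simp)

/-! ## One-step unfolding to the inline collision sums -/

/-- **Integration against the collision measure, inline form.** For a curve in the hard-sphere
domain with finitely many collision times in `S` (e.g. a hard-sphere trajectory on a bounded
window), `∫ f dκ` is the double contact sum
`∑ᶠ t ∈ collisionTimes ∩ S, ∑ i, ∑ j, if i ≠ j ∧ ‖x_i - x_j‖ = ε then f (t, x_i, ε⁻¹ (x_i - x_j), v_i⁻, v_j⁻) else 0`
with the pre-collisional velocities spelled `reflectVel (x_i - x_j) (v_i, v_j)` — verbatim the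
collision functional inlined in route statements (Pulvirenti–Simonella 2015 §3 Thm 1: the
collision terms of the empirical BBGKY / microscopic Enskog identity).
[cite: PulvirentiSimonella2015, §3 Thm 1] -/
theorem integral_collisionMeasure_eq_finsum_ite [MeasurableSingletonClass X] {E : Type*}
    [NormedAddCommGroup E] [NormedSpace ℝ E] [CompleteSpace E] {γ : ℝ → Config N d X}
    (hγ : ∀ t, γ t ∈ hardSphereDomain G N ε) {S : Set ℝ}
    (hfin : (collisionTimes G ε γ ∩ S).Finite)
    (f : ℝ × X × EuclideanSpace ℝ d × EuclideanSpace ℝ d × EuclideanSpace ℝ d → E) :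
    ∫ m, f m ∂collisionMeasure G ε γ S =
      ∑ᶠ t ∈ collisionTimes G ε γ ∩ S, ∑ i, ∑ j,
        if i ≠ j ∧ ‖G.sepVec (γ t i).1 (γ t j).1‖ = ε then
          f (t, (γ t i).1, ε⁻¹ • G.sepVec (γ t i).1 (γ t j).1,
            (reflectVel (G.sepVec (γ t i).1 (γ t j).1) ((γ t i).2, (γ t j).2)).1,
            (reflectVel (G.sepVec (γ t i).1 (γ t j).1) ((γ t i).2, (γ t j).2)).2)
        else 0 := by
  rw [integral_collisionMeasure hfin, collisionSum_eq_collisionPairSum,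
    collisionPairSum_eq_finsum_ite hγ]
  rfl

/-- Lower Lebesgue integration against the collision measure, inline form (curve in the
hard-sphere domain, finitely many collision times in `S`). [folklore] -/
theorem lintegral_collisionMeasure_eq_finsum_ite [MeasurableSingletonClass X]
    {γ : ℝ → Config N d X} (hγ : ∀ t, γ t ∈ hardSphereDomain G N ε) {S : Set ℝ}
    (hfin : (collisionTimes G ε γ ∩ S).Finite)
    (f : ℝ × X × EuclideanSpace ℝ d × EuclideanSpace ℝ d × EuclideanSpace ℝ d → ℝ≥0∞) :
    ∫⁻ m, f m ∂collisionMeasure G ε γ S =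
      ∑ᶠ t ∈ collisionTimes G ε γ ∩ S, ∑ i, ∑ j,
        if i ≠ j ∧ ‖G.sepVec (γ t i).1 (γ t j).1‖ = ε then
          f (t, (γ t i).1, ε⁻¹ • G.sepVec (γ t i).1 (γ t j).1,
            (reflectVel (G.sepVec (γ t i).1 (γ t j).1) ((γ t i).2, (γ t j).2)).1,
            (reflectVel (G.sepVec (γ t i).1 (γ t j).1) ((γ t i).2, (γ t j).2)).2)
        else 0 := by
  rw [lintegral_collisionMeasure hfin, collisionSum_eq_collisionPairSum,
    collisionPairSum_eq_finsum_ite hγ]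
  rfl

/-! ## Total mass over a closed window -/

/-- **Total mass of the collision measure of a hard-sphere trajectory** over the closed window
`[a, b]` in a hard-sphere regular geometry (`ℝ^d`, or `T^d` with `ε < 1/2`): every collision is
recorded in its two orders `(i, j), (j, i)` (`card_contactPairs_eq_two`), so
`κ(univ) = 2 · numCollisions G ε γ a b`. [folklore] -/
theorem IsHardSphereTrajectory.collisionMeasure_Icc_univ [TopologicalSpace X]
    {γ : ℝ → Config N d X} (h : IsHardSphereTrajectory G ε N γ) (hG : G.IsHardSphereRegular ε)
    (a b : ℝ) :
    collisionMeasure G ε γ (Icc a b) univ = 2 * numCollisions G ε γ a b := by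
  have hfin : (collisionTimes G ε γ ∩ Icc a b).Finite := h.locFinite a b
  rw [collisionMeasure_univ hfin, collisionSum_eq_finset_sum hfin, h.numCollisions_eq a b,
    Finset.card_eq_sum_ones, Nat.cast_sum, Finset.mul_sum]
  refine Finset.sum_congr rfl fun t ht => ?_
  rw [Finset.sum_const, nsmul_eq_mul, mul_one, Nat.cast_one, mul_one,
    h.card_contactPairs_eq_two hG ((Set.Finite.mem_toFinset hfin).1 ht).1, Nat.cast_ofNat]

end Curve

/-! ## Along a hard-sphere flow -/

namespace HardSphereFlow

variable [MeasureSpace X] [TopologicalSpace X] (Φ : HardSphereFlow G ε N)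

/-- The empirical collision measure of any orbit over any set of times is a finite measure
(compare `isFiniteMeasure_empiricalCollisionMeasure`: good datum, bounded window). [folklore] -/
theorem isFiniteMeasure_empiricalCollisionMeasure' (S : Set ℝ) (z : Config N d X) :
    IsFiniteMeasure (Φ.empiricalCollisionMeasure S z) :=
  isFiniteMeasure_collisionMeasure' G ε _ S

/-- Every function is Bochner integrable against the empirical collision measure of an orbit.
[folklore] -/
theorem integrable_empiricalCollisionMeasure [MeasurableSingletonClass X] {E : Type*}
    [NormedAddCommGroup E] (S : Set ℝ) (z : Config N d X)
    (f : ℝ × X × EuclideanSpace ℝ d × EuclideanSpace ℝ d × EuclideanSpace ℝ d → E) :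
    Integrable f (Φ.empiricalCollisionMeasure S z) :=
  integrable_collisionMeasure _ S f

/-- **Integration against the empirical collision measure of a good orbit, inline form**: for
`z ∈ Φ.good` and a bounded set of times `S ⊆ [a, b]`,
`∫ f d(Φ.empiricalCollisionMeasure S z) = ∑ᶠ s ∈ collisionTimes ∩ S, ∑ i, ∑ j, if i ≠ j ∧ ‖x_i(s) - x_j(s)‖ = ε then f (s, x_i(s), ε⁻¹ (x_i(s) - x_j(s)), v_i⁻(s), v_j⁻(s)) else 0`,
pre-collisional velocities spelled `reflectVel (x_i - x_j) (v_i(s), v_j(s))` of the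
right-continuous orbit — the collision functional `K_N[F]` of route statements is
`(ε/(N+1)) * ∫ F dκ` with `S = Set.Icc 0 τ`. [cite: PulvirentiSimonella2015, §3 Thm 1] -/
theorem integral_empiricalCollisionMeasure_eq_finsum_ite [MeasurableSingletonClass X] {E : Type*}
    [NormedAddCommGroup E] [NormedSpace ℝ E] [CompleteSpace E] {z : Config N d X}
    (hz : z ∈ Φ.good) {S : Set ℝ} {a b : ℝ} (hS : S ⊆ Icc a b)
    (f : ℝ × X × EuclideanSpace ℝ d × EuclideanSpace ℝ d × EuclideanSpace ℝ d → E) :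
    ∫ m, f m ∂Φ.empiricalCollisionMeasure S z =
      ∑ᶠ s ∈ collisionTimes G ε (fun t => Φ.flow t z) ∩ S, ∑ i, ∑ j,
        if i ≠ j ∧ ‖G.sepVec (Φ.flow s z i).1 (Φ.flow s z j).1‖ = ε then
          f (s, (Φ.flow s z i).1, ε⁻¹ • G.sepVec (Φ.flow s z i).1 (Φ.flow s z j).1,
            (reflectVel (G.sepVec (Φ.flow s z i).1 (Φ.flow s z j).1)
              ((Φ.flow s z i).2, (Φ.flow s z j).2)).1,
            (reflectVel (G.sepVec (Φ.flow s z i).1 (Φ.flow s z j).1)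
              ((Φ.flow s z i).2, (Φ.flow s z j).2)).2)
        else 0 :=
  integral_collisionMeasure_eq_finsum_ite (fun t => (Φ.isTrajectory z hz).mem t)
    (Φ.finite_collisionTimes_inter hz hS) f

/-- Lower Lebesgue integration against the empirical collision measure of a good orbit, inline
form (bounded set of times). [folklore] -/
theorem lintegral_empiricalCollisionMeasure_eq_finsum_ite [MeasurableSingletonClass X]
    {z : Config N d X} (hz : z ∈ Φ.good) {S : Set ℝ} {a b : ℝ} (hS : S ⊆ Icc a b)
    (f : ℝ × X × EuclideanSpace ℝ d × EuclideanSpace ℝ d × EuclideanSpace ℝ d → ℝ≥0∞) :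
    ∫⁻ m, f m ∂Φ.empiricalCollisionMeasure S z =
      ∑ᶠ s ∈ collisionTimes G ε (fun t => Φ.flow t z) ∩ S, ∑ i, ∑ j,
        if i ≠ j ∧ ‖G.sepVec (Φ.flow s z i).1 (Φ.flow s z j).1‖ = ε then
          f (s, (Φ.flow s z i).1, ε⁻¹ • G.sepVec (Φ.flow s z i).1 (Φ.flow s z j).1,
            (reflectVel (G.sepVec (Φ.flow s z i).1 (Φ.flow s z j).1)
              ((Φ.flow s z i).2, (Φ.flow s z j).2)).1,
            (reflectVel (G.sepVec (Φ.flow s z i).1 (Φ.flow s z j).1)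
              ((Φ.flow s z i).2, (Φ.flow s z j).2)).2)
        else 0 :=
  lintegral_collisionMeasure_eq_finsum_ite (fun t => (Φ.isTrajectory z hz).mem t)
    (Φ.finite_collisionTimes_inter hz hS) f

/-- **Total mass along a good orbit** over the closed window `[a, b]` in a hard-sphere regular
geometry: `Φ.empiricalCollisionMeasure (Icc a b) z univ = 2 · numCollisions` of the orbit (each
collision in its two orders). [folklore] -/
theorem empiricalCollisionMeasure_Icc_univ (hG : G.IsHardSphereRegular ε) {z : Config N d X}
    (hz : z ∈ Φ.good) (a b : ℝ) :
    Φ.empiricalCollisionMeasure (Icc a b) z univ =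
      2 * numCollisions G ε (fun t => Φ.flow t z) a b :=
  (Φ.isTrajectory z hz).collisionMeasure_Icc_univ hG a b

end HardSphereFlow

end Kinetic

end

end Literature.Analysis.FluidPDE
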